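import Summits.QuantumAdvantage.AdviceFreeQNC0.LayerGrowth
import Summits.QuantumAdvantage.AdviceFreeQNC0.HammingLayerSums
import HarnessLib

/-!
# Cell qa-qnc0 (rung F-Q1, route RingFrame, crux α, line `product`): layer growth in ratio form and
# the binomial comparisons used by weak proportional residue avoidance (`WeakPLDAMSq`)

Support file for `WeakResidueAvoidance.lean` (planner statement HOME/qa-qnc0-p1/Sketch5.lean §18.4
`WeakPLDAMSq`).  With `N_k = #{u : g u ≠ 0, |u| = k}`, `deg g ≤ d < q = 2^j`, `C = C(2q,q)`:

* `layerCount_cpl` — reflection `u ↦ ¬u`: `N_k(cpl g) = N_{n−k}(g)`;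
* `layerCount_up` / `layerCount_down` — `layerGrowth` (Hegedűs) in ratio form,
  `N_k·C(n,k+q) ≤ N_{k+q}·C(n,k)·C` (`k + 2q ≤ n`) and `N_k·C(n,k−q) ≤ N_{k−q}·C(n,k)·C` (`2q ≤ k`),
  and the two-step versions `layerCount_up_two` / `layerCount_down_two` (factor `C²`);
* binomial comparisons: monotonicity towards the middle (`choose_mono_left_half`,
  `choose_mono_right_half`), the one-step ratio `C(n,k)·(k−q+1)^q ≤ C(n,k−q)·(n−k+q)^q`, and, for
  `16q² ≤ n`, `C(n,k) ≤ 3·C(n,k∓q)` one `q`-step away from the middle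
  (`choose_le_three_mul_choose_sub/add`, factor `e^{16q²/n} ≤ e`) and `C(n,k) ≤ 3·C(n,t)` for `t`
  within `q` of the middle (`choose_le_three_mul_choose_near_middle`, via the tree's
  `choose_le_exp_mul_choose`, factor `e^{8q²/n}`).

All folklore/bookkeeping; the only mathematical input is Hegedűs's lemma through `layerGrowth`.
WHAT THIS IS NOT: anything on α.
-/

noncomputable section

namespace Summit.QuantumAdvantage.AdviceFreeQNC0

open Finset
open Literature.Computability.MetaComplexity Literature.Computability.MetaComplexity.Smolensky
open Literature.Computability.MetaComplexity.Hegedus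

variable {n : ℕ}

/-! ### Layer counts and their reflection -/

/-- The layer count `N_k(g) = #{u : g u ≠ 0, |u| = k}`. [folklore] -/
theorem layerCount_eq (g : CubeFn (ZMod 2) n) (k : ℕ) :
    (univ.filter fun u : Fin n → Bool => g u ≠ 0 ∧ wt u = k).card =
      ((layer n k).filter fun u => g u ≠ 0).card := by
  unfold layer
  rw [Finset.filter_filter]
  exact congrArg Finset.card (Finset.filter_congr fun u _ => by tauto)

/-- Reflection `u ↦ ¬u` swaps the layers `k` and `n − k`: `N_k(cpl g) = N_{n−k}(g)` for `k ≤ n`.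
[folklore] -/
theorem layerCount_cpl (g : CubeFn (ZMod 2) n) {k : ℕ} (hk : k ≤ n) :
    (univ.filter fun u : Fin n → Bool => cpl g u ≠ 0 ∧ wt u = k).card =
      (univ.filter fun u : Fin n → Bool => g u ≠ 0 ∧ wt u = n - k).card := by
  refine Finset.card_bij (fun u _ => fun i => !u i) (fun u hu => ?_) (fun u _ v _ h => ?_) (fun v hv => ?_)
  · have h := (Finset.mem_filter.1 hu).2
    refine Finset.mem_filter.2 ⟨Finset.mem_univ _, h.1, ?_⟩
    rw [wt_not, h.2]
  · funext i
    have := congrFun h i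
    simpa using this
  · have h := (Finset.mem_filter.1 hv).2
    refine ⟨fun i => !v i, Finset.mem_filter.2 ⟨Finset.mem_univ _, ?_, ?_⟩, ?_⟩
    · show g (fun i => !!v i) ≠ 0
      simpa using h.1
    · rw [wt_not, h.2]; omega
    · funext i; simp

/-! ### Layer growth in ratio form, up and down, one and two steps -/

/-- `C(n,k)·C(n−k,q) = C(n,k+q)·C(k+q,q)`. [folklore] -/
private theorem choose_mul_choose_sub (n k q : ℕ) :
    n.choose k * (n - k).choose q = n.choose (k + q) * (k + q).choose q := by
  have h := (Nat.choose_mul (n := n) (k := k + q) (s := k) (Nat.le_add_right k q)).symm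
  rw [Nat.add_sub_cancel_left] at h
  rw [h, Nat.choose_symm_add]

/-- One step up: `N_k·C(n,k+q) ≤ N_{k+q}·C(n,k)·C(2q,q)` for `k + 2q ≤ n` (`q = 2^j > deg g`).
[cite: Srinivasan2023, Lemma 1.1 (Hegedűs's lemma)] -/
theorem layerCount_up {j d k : ℕ} (hd : d < 2 ^ j) (hk : k + 2 * 2 ^ j ≤ n) {g : CubeFn (ZMod 2) n}
    (hg : g ∈ lowDeg (ZMod 2) n d) :
    (univ.filter fun u : Fin n → Bool => g u ≠ 0 ∧ wt u = k).card * n.choose (k + 2 ^ j) ≤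
      (univ.filter fun u : Fin n → Bool => g u ≠ 0 ∧ wt u = k + 2 ^ j).card * n.choose k *
        (2 * 2 ^ j).choose (2 ^ j) := by
  set q := 2 ^ j
  have h := layerGrowth n j d k hd hk g hg
  have hpos : 0 < (k + q).choose q := Nat.choose_pos (Nat.le_add_left q k)
  refine Nat.le_of_mul_le_mul_right ?_ hpos
  calc (univ.filter fun u : Fin n → Bool => g u ≠ 0 ∧ wt u = k).card * n.choose (k + q) * (k + q).choose q
      = (univ.filter fun u : Fin n → Bool => g u ≠ 0 ∧ wt u = k).card * (n - k).choose q * n.choose k := by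
        rw [mul_assoc, ← choose_mul_choose_sub, mul_assoc, mul_comm (n.choose k)]
    _ ≤ (univ.filter fun u : Fin n → Bool => g u ≠ 0 ∧ wt u = k + q).card * (k + q).choose q *
          (2 * q).choose q * n.choose k := Nat.mul_le_mul_right _ h
    _ = _ := by ring

/-- One step down (reflection of `layerCount_up`): `N_k·C(n,k−q) ≤ N_{k−q}·C(n,k)·C(2q,q)` for
`2q ≤ k ≤ n`. [cite: Srinivasan2023, Lemma 1.1 (Hegedűs's lemma)] -/
theorem layerCount_down {j d k : ℕ} (hd : d < 2 ^ j) (hk : 2 * 2 ^ j ≤ k) (hkn : k ≤ n)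
    {g : CubeFn (ZMod 2) n} (hg : g ∈ lowDeg (ZMod 2) n d) :
    (univ.filter fun u : Fin n → Bool => g u ≠ 0 ∧ wt u = k).card * n.choose (k - 2 ^ j) ≤
      (univ.filter fun u : Fin n → Bool => g u ≠ 0 ∧ wt u = k - 2 ^ j).card * n.choose k *
        (2 * 2 ^ j).choose (2 ^ j) := by
  set q := 2 ^ j
  have h := layerCount_up (k := n - k) hd (by omega) (cpl_mem_lowDeg hg)
  rw [layerCount_cpl g (by omega), layerCount_cpl g (by omega),
    show n - (n - k) = k by omega, show n - (n - k + q) = k - q by omega,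
    show n - k + q = n - (k - q) by omega, Nat.choose_symm (by omega), Nat.choose_symm hkn] at h
  exact h

/-- Two steps up: `N_k·C(n,k+2q) ≤ N_{k+2q}·C(n,k)·C(2q,q)²` for `k + 3q ≤ n`.
[cite: Srinivasan2023, Lemma 1.1 (Hegedűs's lemma)] -/
theorem layerCount_up_two {j d k : ℕ} (hd : d < 2 ^ j) (hk : k + 3 * 2 ^ j ≤ n)
    {g : CubeFn (ZMod 2) n} (hg : g ∈ lowDeg (ZMod 2) n d) :
    (univ.filter fun u : Fin n → Bool => g u ≠ 0 ∧ wt u = k).card * n.choose (k + 2 * 2 ^ j) ≤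
      (univ.filter fun u : Fin n → Bool => g u ≠ 0 ∧ wt u = k + 2 * 2 ^ j).card * n.choose k *
        (2 * 2 ^ j).choose (2 ^ j) ^ 2 := by
  set q := 2 ^ j
  set C := (2 * q).choose q
  set N0 := (univ.filter fun u : Fin n → Bool => g u ≠ 0 ∧ wt u = k).card
  set N1 := (univ.filter fun u : Fin n → Bool => g u ≠ 0 ∧ wt u = k + q).card
  set N2 := (univ.filter fun u : Fin n → Bool => g u ≠ 0 ∧ wt u = k + 2 * q).card
  have h1 : N0 * n.choose (k + q) ≤ N1 * n.choose k * C := layerCount_up hd (by omega) hg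
  have h2 : N1 * n.choose (k + q + q) ≤ N2 * n.choose (k + q) * C := by
    have := layerCount_up (k := k + q) hd (by omega) hg
    rwa [show k + q + q = k + 2 * q by ring] at this ⊢
  rw [show k + q + q = k + 2 * q by ring] at h2
  have hpos : 0 < n.choose (k + q) := Nat.choose_pos (by omega)
  refine Nat.le_of_mul_le_mul_right ?_ hpos
  calc N0 * n.choose (k + 2 * q) * n.choose (k + q) = N0 * n.choose (k + q) * n.choose (k + 2 * q) := by ring
    _ ≤ N1 * n.choose k * C * n.choose (k + 2 * q) := Nat.mul_le_mul_right _ h1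
    _ = N1 * n.choose (k + 2 * q) * (n.choose k * C) := by ring
    _ ≤ N2 * n.choose (k + q) * C * (n.choose k * C) := Nat.mul_le_mul_right _ h2
    _ = N2 * n.choose k * C ^ 2 * n.choose (k + q) := by ring

/-- Two steps down: `N_k·C(n,k−2q) ≤ N_{k−2q}·C(n,k)·C(2q,q)²` for `3q ≤ k ≤ n`.
[cite: Srinivasan2023, Lemma 1.1 (Hegedűs's lemma)] -/
theorem layerCount_down_two {j d k : ℕ} (hd : d < 2 ^ j) (hk : 3 * 2 ^ j ≤ k) (hkn : k ≤ n)
    {g : CubeFn (ZMod 2) n} (hg : g ∈ lowDeg (ZMod 2) n d) :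
    (univ.filter fun u : Fin n → Bool => g u ≠ 0 ∧ wt u = k).card * n.choose (k - 2 * 2 ^ j) ≤
      (univ.filter fun u : Fin n → Bool => g u ≠ 0 ∧ wt u = k - 2 * 2 ^ j).card * n.choose k *
        (2 * 2 ^ j).choose (2 ^ j) ^ 2 := by
  set q := 2 ^ j
  have h := layerCount_up_two (k := n - k) hd (by omega) (cpl_mem_lowDeg hg)
  rw [layerCount_cpl g (by omega), layerCount_cpl g (by omega),
    show n - (n - k) = k by omega, show n - (n - k + 2 * q) = k - 2 * q by omega,
    show n - k + 2 * q = n - (k - 2 * q) by omega, Nat.choose_symm (by omega), Nat.choose_symm hkn] at h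
  exact h

/-! ### Binomial coefficients: monotone towards the middle; one step of length `q` costs `≤ e` -/

/-- `C(n,a) ≤ C(n,b)` for `a ≤ b ≤ n/2`. [folklore] -/
theorem choose_mono_left_half {n a b : ℕ} (hab : a ≤ b) (hb : 2 * b ≤ n) : n.choose a ≤ n.choose b := by
  induction b, hab using Nat.le_induction with
  | base => exact le_rfl
  | succ b hab ih =>
    exact (ih (by omega)).trans (Nat.choose_le_succ_of_lt_half_left (by omega))

/-- `C(n,a) ≤ C(n,b)` for `n/2 ≤ b ≤ a ≤ n`. [folklore] -/
theorem choose_mono_right_half {n a b : ℕ} (hba : b ≤ a) (han : a ≤ n) (hb : n ≤ 2 * b) :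
    n.choose a ≤ n.choose b := by
  rw [← Nat.choose_symm han, ← Nat.choose_symm (hba.trans han)]
  exact choose_mono_left_half (by omega) (by omega)

/-- `C(n,k)·(k−q+1)^q ≤ C(n,k−q)·(n−k+q)^q` for `q ≤ k ≤ n` (one-step ratios
`C(n,i)/C(n,i−1) = (n−i+1)/i ≤ (n−k+q)/(k−q+1)` for `i ∈ (k−q, k]`). [folklore] -/
theorem choose_mul_pow_le_choose_sub_mul_pow (n : ℕ) :
    ∀ q k : ℕ, q ≤ k → k ≤ n → n.choose k * (k - q + 1) ^ q ≤ n.choose (k - q) * (n - k + q) ^ q := by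
  intro q
  induction q with
  | zero => intro k _ _; simp
  | succ q ih =>
    intro k hqk hkn
    have h1 := ih k (by omega) hkn
    -- one more step at the bottom: `C(n, k−q)·(k−q) = C(n, k−q−1)·(n−k+q+1)`
    have hstep : n.choose (k - q) * (k - q) = n.choose (k - q - 1) * (n - k + q + 1) := by
      have h := Nat.choose_succ_right_eq n (k - q - 1)
      rw [show k - q - 1 + 1 = k - q by omega, show n - (k - q - 1) = n - k + q + 1 by omega] at h
      exact h
    calc n.choose k * (k - (q + 1) + 1) ^ (q + 1)
        = n.choose k * (k - q) ^ q * (k - q) := by rw [show k - (q + 1) + 1 = k - q by omega, pow_succ, mul_assoc]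
      _ ≤ n.choose k * (k - q + 1) ^ q * (k - q) :=
          Nat.mul_le_mul_right _ (Nat.mul_le_mul_left _ (Nat.pow_le_pow_left (Nat.le_succ _) _))
      _ ≤ n.choose (k - q) * (n - k + q) ^ q * (k - q) := Nat.mul_le_mul_right _ h1
      _ = n.choose (k - q - 1) * (n - k + q + 1) * (n - k + q) ^ q := by
          rw [mul_assoc, mul_comm ((n - k + q) ^ q), ← mul_assoc, hstep]
      _ ≤ n.choose (k - q - 1) * (n - k + q + 1) * (n - k + q + 1) ^ q :=
          Nat.mul_le_mul_left _ (Nat.pow_le_pow_left (Nat.le_succ _) _)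
      _ = n.choose (k - (q + 1)) * (n - k + (q + 1)) ^ (q + 1) := by
          rw [show k - (q + 1) = k - q - 1 by omega, show n - k + (q + 1) = n - k + q + 1 by omega,
            pow_succ, mul_assoc, mul_comm ((n - k + q + 1) ^ q)]

/-- `e^{1} ≤ 3`. [folklore] -/
private theorem exp_one_le_three : Real.exp 1 ≤ 3 := by
  have := Real.exp_one_lt_d9; linarith

/-- One step of length `q` away from the middle, just below it, costs at most the factor `e ≤ 3`:
for `2k ≤ n < 2(k+q)` and `16q² ≤ n` (`q ≥ 1`), `C(n,k) ≤ 3·C(n,k−q)`. [folklore] -/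
theorem choose_le_three_mul_choose_sub {n k q : ℕ} (hq : 1 ≤ q) (hn : 16 * q ^ 2 ≤ n)
    (hk1 : 2 * k ≤ n) (hk2 : n < 2 * (k + q)) : (n.choose k : ℝ) ≤ 3 * n.choose (k - q) := by
  have hqn : 8 * q ≤ n := by nlinarith
  have hqk : q ≤ k := by omega
  have hkn : k ≤ n := by omega
  have h := choose_mul_pow_le_choose_sub_mul_pow n q k hqk hkn
  have hA : (0 : ℝ) < (k - q + 1 : ℕ) := by positivity
  -- the ratio `(n−k+q)/(k−q+1) ≤ 1 + 16q/n`
  have hratio : ((n - k + q : ℕ) : ℝ) ≤ ((k - q + 1 : ℕ) : ℝ) * (1 + 16 * (q : ℝ) / n) := by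
    have hn0 : (0 : ℝ) < n := by
      have : 0 < n := by omega
      exact_mod_cast this
    -- `(n−k+q) − (k−q+1) ≤ 4q ≤ (k−q+1)·16q/n`
    have h4 : ((n - k + q : ℕ) : ℝ) - ((k - q + 1 : ℕ) : ℝ) ≤ 4 * (q : ℝ) := by
      have : (n - k + q : ℕ) ≤ (k - q + 1 : ℕ) + 4 * q := by omega
      have := (Nat.cast_le (α := ℝ)).2 this
      push_cast at this ⊢
      linarith
    have h5 : 4 * (q : ℝ) ≤ ((k - q + 1 : ℕ) : ℝ) * (16 * (q : ℝ)) / n := by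
      rw [le_div_iff₀ hn0]
      have : 4 * q * n ≤ (k - q + 1) * (16 * q) := by nlinarith [show n ≤ 4 * (k - q + 1) by omega]
      have := (Nat.cast_le (α := ℝ)).2 this
      push_cast at this ⊢
      linarith
    have hexpand : ((k - q + 1 : ℕ) : ℝ) * (1 + 16 * (q : ℝ) / n) =
        ((k - q + 1 : ℕ) : ℝ) + ((k - q + 1 : ℕ) : ℝ) * (16 * (q : ℝ)) / n := by ring
    rw [hexpand]
    linarith
  -- hence `C(n,k)·A^q ≤ C(n,k−q)·(A(1+16q/n))^q` and `(1+16q/n)^q ≤ e^{16q²/n} ≤ e`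
  have hpow : ((n - k + q : ℕ) : ℝ) ^ q ≤ (((k - q + 1 : ℕ) : ℝ) * (1 + 16 * (q : ℝ) / n)) ^ q :=
    pow_le_pow_left₀ (by positivity) hratio q
  have hexp : (1 + 16 * (q : ℝ) / n) ^ q ≤ 3 := by
    have h1 : (1 + 16 * (q : ℝ) / n) ≤ Real.exp (16 * (q : ℝ) / n) := by
      have := Real.add_one_le_exp (16 * (q : ℝ) / n); linarith
    have h2 : (1 + 16 * (q : ℝ) / n) ^ q ≤ Real.exp (16 * (q : ℝ) / n) ^ q :=
      pow_le_pow_left₀ (by positivity) h1 q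
    have h3 : Real.exp (16 * (q : ℝ) / n) ^ q = Real.exp (16 * (q : ℝ) ^ 2 / n) := by
      rw [← Real.exp_nat_mul]; congr 1; ring
    have h4 : Real.exp (16 * (q : ℝ) ^ 2 / n) ≤ Real.exp 1 := by
      rw [Real.exp_le_exp, div_le_one (by exact_mod_cast (show 0 < n by omega))]
      exact_mod_cast hn
    linarith [exp_one_le_three]
  have hmain : (n.choose k : ℝ) * ((k - q + 1 : ℕ) : ℝ) ^ q ≤
      3 * n.choose (k - q) * ((k - q + 1 : ℕ) : ℝ) ^ q := by
    have hcast : (n.choose k : ℝ) * ((k - q + 1 : ℕ) : ℝ) ^ q ≤ n.choose (k - q) * ((n - k + q : ℕ) : ℝ) ^ q := by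
      exact_mod_cast h
    calc (n.choose k : ℝ) * ((k - q + 1 : ℕ) : ℝ) ^ q ≤ n.choose (k - q) * ((n - k + q : ℕ) : ℝ) ^ q := hcast
      _ ≤ n.choose (k - q) * (((k - q + 1 : ℕ) : ℝ) * (1 + 16 * (q : ℝ) / n)) ^ q :=
          mul_le_mul_of_nonneg_left hpow (by positivity)
      _ = n.choose (k - q) * (1 + 16 * (q : ℝ) / n) ^ q * ((k - q + 1 : ℕ) : ℝ) ^ q := by rw [mul_pow]; ring
      _ ≤ n.choose (k - q) * 3 * ((k - q + 1 : ℕ) : ℝ) ^ q :=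
          mul_le_mul_of_nonneg_right (mul_le_mul_of_nonneg_left hexp (by positivity)) (by positivity)
      _ = 3 * n.choose (k - q) * ((k - q + 1 : ℕ) : ℝ) ^ q := by ring
  exact le_of_mul_le_mul_right hmain (by positivity)

/-- Mirror: one step of length `q` upwards, just above the middle: for `n ≤ 2k < n + 2q`,
`16q² ≤ n`, `C(n,k) ≤ 3·C(n,k+q)`. [folklore] -/
theorem choose_le_three_mul_choose_add {n k q : ℕ} (hq : 1 ≤ q) (hn : 16 * q ^ 2 ≤ n)
    (hk1 : n ≤ 2 * k) (hk2 : 2 * k < n + 2 * q) (hkn : k + q ≤ n) :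
    (n.choose k : ℝ) ≤ 3 * n.choose (k + q) := by
  have h := choose_le_three_mul_choose_sub (n := n) (k := n - k) (q := q) hq hn (by omega) (by omega)
  rw [Nat.choose_symm (by omega), show n - k - q = n - (k + q) by omega, Nat.choose_symm hkn] at h
  exact h

/-- Near the middle: for `16q² ≤ n`, `q ≥ 1`, and `t` within `q` of the middle
(`n/2 ≤ t + q`, `t ≤ n − n/2 + q`), `C(n,k) ≤ 3·C(n,t)` for every `k`
(`choose_le_exp_mul_choose` with `e^{8q²/n} ≤ e^{1/2}`). [folklore] -/
theorem choose_le_three_mul_choose_near_middle {n q t : ℕ} (hq : 1 ≤ q) (hn : 16 * q ^ 2 ≤ n)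
    (ht1 : n / 2 ≤ t + q) (ht2 : t ≤ n - n / 2 + q) (k : ℕ) : (n.choose k : ℝ) ≤ 3 * n.choose t := by
  have hqn : 8 * q ≤ n := by nlinarith
  have h := choose_le_exp_mul_choose hqn ht1 ht2 k
  have hexp : Real.exp (8 * (q : ℝ) ^ 2 / n) ≤ 3 := by
    have h4 : Real.exp (8 * (q : ℝ) ^ 2 / n) ≤ Real.exp 1 := by
      rw [Real.exp_le_exp, div_le_one (by exact_mod_cast (show 0 < n by omega))]
      have : 8 * q ^ 2 ≤ n := by omega
      exact_mod_cast this
    linarith [exp_one_le_three]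
  calc (n.choose k : ℝ) ≤ Real.exp (8 * (q : ℝ) ^ 2 / n) * n.choose t := h
    _ ≤ 3 * n.choose t := mul_le_mul_of_nonneg_right hexp (by positivity)


end Summit.QuantumAdvantage.AdviceFreeQNC0
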